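import Summits.QuantumAdvantage.QuantumAdvantage.Theorems.CubicForrelationSignedCubicForrelationInPrBPPStructureNeedsDillon
import Summits.QuantumAdvantage.QuantumAdvantage.Theorems.CubicForrelationExactPairsMaioranaMcFarlandDillonNormalForm
import Summits.QuantumAdvantage.QuantumAdvantage.Theorems.CubicForrelationExactPairsMaioranaMcFarlandDualOfForrelation
import HarnessLib

/-!
# Item `CubicForrelation.SignedCubicForrelationInPrBPP` (stmt-QuantumAdvantage-13933) — `stub_structure` implies r5

By-name bridge between two chains of route `QuantumAdvantage/CubicForrelation`. The registered sufficient stub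
`stub_structure` of the r7 line `polar-radical-seeds` (one-sided logarithmic M-defect for every cubic pair with
`|Φ| ≥ 3/5`; it empties the residue `stub_residueR`, `residueR_of_structure`) IMPLIES the route's classification item
r5 `ExactPairsMaioranaMcFarland` (stmt-QuantumAdvantage-2205) outright:

* `exact_pair_halfdim_of_structure` (`…StructureNeedsDillon.lean`, this seat): under `stub_structure` the second
  function of every exact cubic pair on `m + m` bits has a half-dimensional M-subspace (M-defect super-additivity under
  direct sums, `Φ` multiplicative);
* `stub_dual_of_forrelation` (r5 line, landed): `forrelation f g = 1` makes `g` bent with dual `f`;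
* `stub_dillon_normal_form` (r5 line, landed): a bent function with a half-dimensional M-subspace is completed
  Maiorana–McFarland in the route decl's own normal form (Dillon 1974; Carlet 2021, Prop. 54).

Hence `ExactPairsMaioranaMcFarland_of_structure : stub_structure → ExactPairsMaioranaMcFarland`: the r7 line's
structural conjecture is at least as strong as r5, and r5's cheapest falsifier (one cubic bent function outside the
completed MM class with a cubic dual) kills it. No new mathematics in this file — composition only.
-/

noncomputable section

set_option linter.dupNamespace false -- D-0017: single-problem summit ⇒ `QuantumAdvantage.QuantumAdvantage` by design

namespace Summit.QuantumAdvantage.QuantumAdvantage.Theorems.SignedCubicForrelationInPrBPP.DirectSumDefect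

open Finset
open Literature.Computability.QuantumComplexity
open Literature.Computability.QuantumComplexity.BuzetChailloux (bxor zeroVec)
open Summit.QuantumAdvantage.QuantumAdvantage.Theses.CubicForrelation (ExactPairsMaioranaMcFarland)
open Summit.QuantumAdvantage.QuantumAdvantage.Theorems.CubicForrelation.ExactPairsMaioranaMcFarland
  (stub_dual_of_forrelation stub_dillon_normal_form)

/-- **`stub_structure` implies r5 `ExactPairsMaioranaMcFarland`.** If every cubic pair on evenly many bits with
`|Φ| ≥ 3/5` has a `⊕`-closed `V ∋ 0` with `2ⁿ ≤ |V|²(n+2)^{2c}` on whose cosets one of the two functions is affine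
(the registered signature of `stub_structure`, verbatim), then every exact cubic pair is completed Maiorana–McFarland
in the sense of the route decl `ExactPairsMaioranaMcFarland`. -/
theorem ExactPairsMaioranaMcFarland_of_structure
    (hS : ∃ c : ℕ, ∀ (n : ℕ), Even n → ∀ f g : (Fin n → Bool) → Bool,
      IsDegLeFun 3 f → IsDegLeFun 3 g → (3 / 5 : ℝ) ≤ |forrelation f g| →
      ∃ V : Finset (Fin n → Bool), zeroVec ∈ V ∧ (∀ x ∈ V, ∀ y ∈ V, bxor x y ∈ V) ∧
        2 ^ n ≤ V.card ^ 2 * (n + 2) ^ (2 * c) ∧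
        ((∀ u ∈ V, ∀ v ∈ V, ∀ y, (f y ^^ f (bxor y u) ^^ f (bxor y v) ^^ f (bxor y (bxor u v))) = false) ∨
         (∀ u ∈ V, ∀ v ∈ V, ∀ y, (g y ^^ g (bxor y u) ^^ g (bxor y v) ^^ g (bxor y (bxor u v))) = false))) :
    ExactPairsMaioranaMcFarland := by
  intro m f g hf hg hΦ
  obtain ⟨V, -, hadd, hcard, hM⟩ := exact_pair_halfdim_of_structure hS ⟨m, rfl⟩ f g hf hg hΦ
  refine stub_dillon_normal_form m f g (stub_dual_of_forrelation m f g hΦ) ⟨V, hadd, ?_, fun a ha b hb x => ?_⟩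
  · have h2 : ((V.card : ℕ) : ℝ) = (2 : ℝ) ^ m := by
      have h' : ((V.card : ℕ) : ℝ) ^ 2 = ((2 : ℝ) ^ m) ^ 2 := by rw [hcard, ← pow_mul]; ring
      exact (pow_left_inj₀ (by positivity) (by positivity) two_ne_zero).1 h'
    exact_mod_cast h2
  · rw [bxor_assoc]
    exact hM a ha b hb x

end Summit.QuantumAdvantage.QuantumAdvantage.Theorems.SignedCubicForrelationInPrBPP.DirectSumDefect

end
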